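import Summits.HubbardSuperconductivity.HubbardSuperconductivity.Theorems.AnisotropyChordStiffnessDoobGradient

/-!
# Route `AnisotropyChord` / H0 rotor rung: EXCHANGEABILITY COUNT — the mean domain-wall density of a uniform sector state,
# and RUNG FM with the exact constant (port of theory seat `hubbard-h0-rotor-theory-1`, cycle 10, `Sketch10.lean` Part M5,
# memo ROTOR-THEORY-10 §145; work-order v10)

* `Exch.occ/sector/A/B` and the exchangeability identities `card_mul_B` (`V·B = n|S_n|`), **`card_card_pred_mul_A`**
  (`V(V−1)A = n(V−n)|S_n|`), `card_ne_eq_two_mul_A`;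
* on the torus: `sector_sum_wallCount`, **`wallCount_mean_uniform`**, `swapInvariant_of_uniform`, and
  **`windingEnergy_ge_uniform`** (for a non-negative amplitude uniform on the sector `S_n`, normalised:
  `(n(V−n)/(V(V−1)))·L²/2 ≤ W_j(a; g)` for every `g`) with equality at `g = 0` (`windingEnergy_zero_uniform`): the uniform
  sector state has EXACT twist stiffness `Υ_L(n) = n(V−n)/(V(V−1)) → ρ(1−ρ)`.
Typing/proof authority: theory seat `hubbard-h0-rotor-theory-1`, cycle 10.
-/

set_option linter.dupNamespace false

noncomputable section

open Matrix Complex Finset Filter Topology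
open scoped ComplexConjugate
open Literature.MathematicalPhysics.QuantumLattice hiding torusPhase torusNorm
open Literature.Probability.LatticeModels
open Summit.HubbardSuperconductivity.HubbardSuperconductivity.Theorems.AnisotropyChord.InsertionEntropy
  (torusPhase norm_torusPhase IsPerronSectorGroundAmplitude)
open Summit.HubbardSuperconductivity.HubbardSuperconductivity.Theorems.AnisotropyChord.Stiffness

/-! ## Part M5 — EXCHANGEABILITY COUNT: the mean domain-wall density of a uniform sector state is
`2 n (V − n) / (V (V − 1))` per site (stub F2 of memo §145, now proved), and the FM-point floor with the exact constant. -/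

namespace Summit.HubbardSuperconductivity.HubbardSuperconductivity.Theorems.AnisotropyChord.Stiffness.Exch

variable {α : Type*} [Fintype α] [DecidableEq α]

/-- particle number of a `0/1` configuration -/
def occ (σ : α → Fin 2) : ℕ := (univ.filter fun x => σ x = 1).card

/-- the sector of particle number `n` -/
def sector (α : Type*) [Fintype α] [DecidableEq α] (n : ℕ) : Finset (α → Fin 2) :=
  univ.filter fun σ => occ σ = n

/-- `A n x y = #{σ ∈ sector n : σ x = 1, σ y = 0}` -/
def A (n : ℕ) (x y : α) : ℕ := ((sector α n).filter fun σ => σ x = 1 ∧ σ y = 0).card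

/-- `B n x = #{σ ∈ sector n : σ x = 1}` -/
def B (n : ℕ) (x : α) : ℕ := ((sector α n).filter fun σ => σ x = 1).card

open Summit.HubbardSuperconductivity.HubbardSuperconductivity.Theorems.AnisotropyChord.Stiffness.Doob (fin2_eq_zero_or_one)

omit [DecidableEq α] in
/-- The number of ones is invariant under relabelling. [folklore] -/
theorem occ_comp_perm (σ : α → Fin 2) (π : Equiv.Perm α) : occ (σ ∘ π) = occ σ := by
  unfold occ
  rw [Finset.card_filter, Finset.card_filter]
  exact Equiv.sum_comp π (fun z => if σ z = 1 then 1 else 0)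

/-- precomposition with `π⁻¹` as an equivalence of configuration space -/
def precomp (π : Equiv.Perm α) : (α → Fin 2) ≃ (α → Fin 2) where
  toFun σ := σ ∘ π.symm
  invFun σ := σ ∘ π
  left_inv σ := by funext z; simp
  right_inv σ := by funext z; simp

/-- `A` is invariant under relabelling. [folklore] -/
theorem A_perm (n : ℕ) (π : Equiv.Perm α) (x y : α) : A n (π x) (π y) = A n x y := by
  unfold A sector
  rw [Finset.filter_filter, Finset.filter_filter, Finset.card_filter, Finset.card_filter]
  symm
  refine Fintype.sum_equiv (precomp π) _ _ fun σ => ?_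
  simp only [precomp, Equiv.coe_fn_mk, Function.comp_apply, Equiv.symm_apply_apply, occ_comp_perm]

/-- `B` is invariant under relabelling. [folklore] -/
theorem B_perm (n : ℕ) (π : Equiv.Perm α) (x : α) : B n (π x) = B n x := by
  unfold B sector
  rw [Finset.filter_filter, Finset.filter_filter, Finset.card_filter, Finset.card_filter]
  symm
  refine Fintype.sum_equiv (precomp π) _ _ fun σ => ?_
  simp only [precomp, Equiv.coe_fn_mk, Function.comp_apply, Equiv.symm_apply_apply, occ_comp_perm]

/-- `A` is the same for all pairs of distinct sites (exchangeability). -/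
theorem A_const (n : ℕ) {x y x' y' : α} (hxy : x ≠ y) (hxy' : x' ≠ y') : A n x y = A n x' y' := by
  -- π := swap (swap x x' y) y' ∘ swap x x'  sends x ↦ x', y ↦ y'
  set y'' := Equiv.swap x x' y with hy''
  have h1 : (Equiv.swap x x') x = x' := Equiv.swap_apply_left x x'
  have hx'y'' : x' ≠ y'' := by
    intro h
    have : Equiv.swap x x' x' = Equiv.swap x x' y'' := by rw [← h]
    rw [Equiv.swap_apply_right, hy'', Equiv.swap_apply_self] at this
    exact hxy this
  let π : Equiv.Perm α := (Equiv.swap x x').trans (Equiv.swap y'' y')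
  have hπx : π x = x' := by
    show Equiv.swap y'' y' (Equiv.swap x x' x) = x'
    rw [h1]; exact Equiv.swap_apply_of_ne_of_ne hx'y'' hxy'
  have hπy : π y = y' := by
    show Equiv.swap y'' y' (Equiv.swap x x' y) = y'
    rw [← hy'']; exact Equiv.swap_apply_left y'' y'
  rw [← A_perm n π x y, hπx, hπy]

/-- `B n x` does not depend on `x`. [folklore] -/
theorem B_const (n : ℕ) (x x' : α) : B n x = B n x' := by
  rw [← B_perm n (Equiv.swap x x') x, Equiv.swap_apply_left]

/-- `A` is symmetric. [folklore] -/
theorem A_symm (n : ℕ) (x y : α) : A n y x = A n x y := by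
  rw [← A_perm n (Equiv.swap x y) x y, Equiv.swap_apply_left, Equiv.swap_apply_right]

omit [DecidableEq α] in
/-- zeros + ones = volume -/
theorem card_zero_add_occ (σ : α → Fin 2) :
    (univ.filter fun y => σ y = 0).card + occ σ = Fintype.card α := by
  unfold occ
  have h : (univ.filter fun y => σ y = 0) = univ.filter fun y => ¬ σ y = 1 := by
    ext y; simp only [mem_filter, mem_univ, true_and]
    rcases fin2_eq_zero_or_one (σ y) with h | h <;> simp [h]
  rw [h, add_comm, Finset.card_filter_add_card_filter_not, Finset.card_univ]

/-- double count 1: `Σ_{y ≠ x} A(x,y) = (V − n) · B(x)` -/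
theorem sum_A_erase (n : ℕ) (x : α) :
    ∑ y ∈ univ.erase x, A n x y = (Fintype.card α - n) * B n x := by
  unfold A B
  simp only [Finset.card_filter]
  rw [Finset.sum_comm, Finset.mul_sum]
  refine sum_congr rfl fun σ hσ => ?_
  have hn : occ σ = n := by unfold sector at hσ; exact (mem_filter.1 hσ).2
  by_cases h1 : σ x = 1
  · simp only [h1, true_and, if_true, mul_one]
    have hsplit : ∑ y ∈ univ.erase x, (if σ y = 0 then 1 else 0 : ℕ) = ∑ y, (if σ y = 0 then 1 else 0 : ℕ) := by
      rw [← Finset.sum_erase_add univ _ (mem_univ x)]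
      simp [h1]
    rw [hsplit, ← Finset.card_filter, ← card_zero_add_occ σ, hn, Nat.add_sub_cancel]
  · simp [h1]

/-- double count 2: `Σ_x B(x) = n · |sector n|` -/
theorem sum_B (n : ℕ) : ∑ x : α, B n x = n * (sector α n).card := by
  unfold B
  simp only [Finset.card_filter]
  rw [Finset.sum_comm]
  have h : ∀ σ ∈ sector α n, ∑ x, (if σ x = 1 then 1 else 0 : ℕ) = n := by
    intro σ hσ
    have hn : occ σ = n := by unfold sector at hσ; exact (mem_filter.1 hσ).2
    rw [← hn]; unfold occ; rw [Finset.card_filter]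
  rw [Finset.sum_congr rfl h, Finset.sum_const, smul_eq_mul, mul_comm]

/-- `V · B(x) = n |sector n|` -/
theorem card_mul_B (n : ℕ) (x : α) : Fintype.card α * B n x = n * (sector α n).card := by
  rw [← sum_B n, ← Finset.card_univ, Finset.card_eq_sum_ones, Finset.sum_mul]
  simp only [one_mul]
  exact sum_congr rfl fun x' _ => B_const n x x'

/-- `(V − 1) · A(x,y) = (V − n) · B(x)` for `x ≠ y` -/
theorem pred_card_mul_A (n : ℕ) {x y : α} (hxy : x ≠ y) :
    (Fintype.card α - 1) * A n x y = (Fintype.card α - n) * B n x := by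
  rw [← sum_A_erase n x, ← Finset.card_univ, ← Finset.card_erase_of_mem (mem_univ x),
    Finset.card_eq_sum_ones, Finset.sum_mul]
  simp only [one_mul]
  refine sum_congr rfl fun y' hy' => ?_
  exact A_const n hxy (Finset.ne_of_mem_erase hy').symm

/-- **Exchangeability count**: `V (V − 1) A(x,y) = n (V − n) |sector n|` for `x ≠ y`. -/
theorem card_card_pred_mul_A (n : ℕ) {x y : α} (hxy : x ≠ y) :
    Fintype.card α * (Fintype.card α - 1) * A n x y = n * (Fintype.card α - n) * (sector α n).card := by
  rw [mul_assoc, pred_card_mul_A n hxy, mul_left_comm, card_mul_B n x]; ring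

/-- domain walls across `(x, y)` inside the sector: `N(x,y) = 2 A(x,y)` -/
theorem card_ne_eq_two_mul_A (n : ℕ) (x y : α) :
    ((sector α n).filter fun σ => σ x ≠ σ y).card = 2 * A n x y := by
  have hsplit : ((sector α n).filter fun σ => σ x ≠ σ y)
      = ((sector α n).filter fun σ => σ x = 1 ∧ σ y = 0) ∪ ((sector α n).filter fun σ => σ y = 1 ∧ σ x = 0) := by
    ext σ
    simp only [mem_filter, mem_union]
    rcases fin2_eq_zero_or_one (σ x) with hx | hx <;> rcases fin2_eq_zero_or_one (σ y) with hy | hy <;>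
      simp [hx, hy]
  rw [hsplit, Finset.card_union_of_disjoint]
  · change A n x y + A n y x = 2 * A n x y
    rw [A_symm n x y]; ring
  · rw [Finset.disjoint_filter]
    intro σ _ h1 h2
    rw [h1.1] at h2; exact absurd h2.2 (by decide)

end Summit.HubbardSuperconductivity.HubbardSuperconductivity.Theorems.AnisotropyChord.Stiffness.Exch

namespace Summit.HubbardSuperconductivity.HubbardSuperconductivity.Theorems.AnisotropyChord.Stiffness.Doob

open Summit.HubbardSuperconductivity.HubbardSuperconductivity.Theorems.AnisotropyChord.Stiffness.Exch

variable {L : ℕ} [NeZero L]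

/-- Sector sum of the domain-wall count: `(V − 1) Σ_{σ ∈ S_n} D_j(σ) = 2 n (V − n) |S_n|`. [folklore: exchangeability] -/
theorem sector_sum_wallCount (hL : 2 ≤ L) (n : ℕ) (hn : n ≤ L ^ 2) (j : Fin 2) :
    ((L : ℝ) ^ 2 - 1) * ∑ σ ∈ sector (TorusSite 2 L) n, wallCount j σ
      = 2 * n * ((L : ℝ) ^ 2 - n) * (sector (TorusSite 2 L) n).card := by
  -- Σ_{σ∈S} D_j σ = Σ_x N(x, x+e_j) = Σ_x 2 A(x, x+e_j)
  have hswap : ∑ σ ∈ sector (TorusSite 2 L) n, wallCount j σ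
      = ∑ x : TorusSite 2 L, (2 * A n x (x + Pi.single j 1) : ℕ) := by
    unfold wallCount
    rw [Finset.sum_comm]
    push_cast
    refine sum_congr rfl fun x _ => ?_
    have := card_ne_eq_two_mul_A (α := TorusSite 2 L) n x (x + Pi.single j 1)
    rw [Finset.card_filter] at this
    have this' := congrArg (fun m : ℕ => (m : ℝ)) this
    push_cast at this'
    rw [← this']
  -- all the A's are equal to A₀ := A n 0 (0 + e_j)
  have hA : ∀ x : TorusSite 2 L, A n x (x + Pi.single j 1) = A n (0 : TorusSite 2 L) (0 + Pi.single j 1) :=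
    fun x => A_const n (add_single_ne_self hL x j).symm (add_single_ne_self hL 0 j).symm
  rw [hswap]
  have hcardT : Fintype.card (TorusSite 2 L) = L ^ 2 := by rw [Fintype.card_fun, ZMod.card, Fintype.card_fin]
  simp only [hA, Finset.sum_const, Finset.card_univ, hcardT, smul_eq_mul]
  push_cast
  have key := card_card_pred_mul_A (α := TorusSite 2 L) n (add_single_ne_self hL (0 : TorusSite 2 L) j).symm
  rw [hcardT] at key
  have key' := congrArg (fun m : ℕ => (m : ℝ)) key
  have h1 : (1 : ℕ) ≤ L ^ 2 := le_trans (by norm_num) (le_trans hL (by nlinarith))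
  push_cast [Nat.cast_sub h1, Nat.cast_sub hn] at key'
  linear_combination (2 : ℝ) * key'

/-- **STUB F2 PROVED — mean domain-wall density of a uniform sector amplitude.**  If `a` is uniform on the
sector `S_n` (and `0` elsewhere) and normalised, then `(V − 1) Σ_σ a(σ)² D_j(σ) = 2 n (V − n)`, `V = L²`.
[new: theory seat hubbard-h0-rotor-theory-1, cycle 10, 2026-08-28] -/
theorem wallCount_mean_uniform (hL : 2 ≤ L) (n : ℕ) (hn : n ≤ L ^ 2) (j : Fin 2)
    {a : TensorIndex (TorusSite 2 L) 2 → ℝ} {u : ℝ} (hunif : ∀ σ, a σ = if occ σ = n then u else 0)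
    (hunit : ∑ σ, a σ ^ 2 = 1) :
    ((L : ℝ) ^ 2 - 1) * ∑ σ, a σ ^ 2 * wallCount j σ = 2 * n * ((L : ℝ) ^ 2 - n) := by
  have hsq : ∀ σ, a σ ^ 2 = if occ σ = n then u ^ 2 else 0 := by
    intro σ; rw [hunif σ]; split_ifs <;> simp
  have hcard : u ^ 2 * (sector (TorusSite 2 L) n).card = 1 := by
    rw [← hunit]; simp only [hsq]
    rw [← Finset.sum_filter, Finset.sum_const, nsmul_eq_mul, mul_comm]; rfl
  have hsum : ∑ σ, a σ ^ 2 * wallCount j σ = u ^ 2 * ∑ σ ∈ sector (TorusSite 2 L) n, wallCount j σ := by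
    simp only [hsq, ite_mul, zero_mul]
    rw [← Finset.sum_filter, Finset.mul_sum]; rfl
  rw [hsum, ← mul_assoc, mul_comm ((L : ℝ) ^ 2 - 1), mul_assoc, sector_sum_wallCount hL n hn j]
  linear_combination (2 * n * ((L : ℝ) ^ 2 - n)) * hcard

/-- An amplitude uniform on a sector is swap-invariant. [folklore] -/
theorem swapInvariant_of_uniform (n : ℕ) {a : TensorIndex (TorusSite 2 L) 2 → ℝ} {u : ℝ}
    (hunif : ∀ σ, a σ = if occ σ = n then u else 0) : SwapInvariant a := by
  intro σ x y
  rw [hunif, hunif, show (σ ∘ ⇑(Equiv.swap x y)) = σ ∘ (Equiv.swap x y : Equiv.Perm (TorusSite 2 L)) from rfl,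
    occ_comp_perm]

/-- **RUNG FM with the exact constant (fixed `L`).**  For a nonnegative amplitude uniform on the sector `S_n`
(the Perron amplitude of the isotropic ferromagnetic point): for every `j` and EVERY potential `g`,
`(n (V − n) / (V (V − 1))) · L²/2 ≤ W_j(a; g)`, with equality at `g = 0`; i.e. the twist stiffness is
`Υ_L = n(V−n)/(V(V−1)) → ρ(1−ρ)`. [new: theory seat hubbard-h0-rotor-theory-1, cycle 10, 2026-08-28] -/
theorem windingEnergy_ge_uniform (hL : 2 ≤ L) (n : ℕ) (hn : n ≤ L ^ 2) (j : Fin 2)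
    {a : TensorIndex (TorusSite 2 L) 2 → ℝ} {u : ℝ} (hunif : ∀ σ, a σ = if occ σ = n then u else 0)
    (ha0 : ∀ σ, 0 ≤ a σ) (hunit : ∑ σ, a σ ^ 2 = 1) (g : TensorIndex (TorusSite 2 L) 2 → ℝ) :
    (n * ((L : ℝ) ^ 2 - n) / ((L : ℝ) ^ 2 * ((L : ℝ) ^ 2 - 1))) * (L : ℝ) ^ 2 / 2 ≤ windingEnergy a j g := by
  have hinv := swapInvariant_of_uniform n hunif
  have hmean := wallCount_mean_uniform hL n hn j hunif hunit
  have hL1 : (1 : ℝ) < (L : ℝ) ^ 2 := by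
    have : (2 : ℝ) ≤ L := by exact_mod_cast hL
    nlinarith
  have hL0 : (0 : ℝ) < (L : ℝ) ^ 2 := by linarith
  refine windingEnergy_ge_of_swapInvariant hinv ha0 j ?_ g
  rw [show 2 * (n * ((L : ℝ) ^ 2 - n) / ((L : ℝ) ^ 2 * ((L : ℝ) ^ 2 - 1))) * (L : ℝ) ^ 2
      = 2 * n * ((L : ℝ) ^ 2 - n) / ((L : ℝ) ^ 2 - 1) by field_simp]
  rw [div_le_iff₀ (by linarith)]
  linarith [hmean]

/-- … and the value is attained at `g = 0`. -/
theorem windingEnergy_zero_uniform (hL : 2 ≤ L) (n : ℕ) (hn : n ≤ L ^ 2) (j : Fin 2)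
    {a : TensorIndex (TorusSite 2 L) 2 → ℝ} {u : ℝ} (hunif : ∀ σ, a σ = if occ σ = n then u else 0)
    (hunit : ∑ σ, a σ ^ 2 = 1) :
    windingEnergy a j 0 = (n * ((L : ℝ) ^ 2 - n) / ((L : ℝ) ^ 2 * ((L : ℝ) ^ 2 - 1))) * (L : ℝ) ^ 2 / 2 := by
  have hmean := wallCount_mean_uniform hL n hn j hunif hunit
  have hL1 : (1 : ℝ) < (L : ℝ) ^ 2 := by
    have : (2 : ℝ) ≤ L := by exact_mod_cast hL
    nlinarith
  rw [windingEnergy_zero_eq (swapInvariant_of_uniform n hunif)]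
  have hne : (L : ℝ) ^ 2 - 1 ≠ 0 := by linarith
  have hne' : (L : ℝ) ^ 2 ≠ 0 := by positivity
  field_simp
  linear_combination (2 : ℝ) * hmean

end Summit.HubbardSuperconductivity.HubbardSuperconductivity.Theorems.AnisotropyChord.Stiffness.Doob
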